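import Summits.BirchSwinnertonDyer.Rank1Residual.GaloisImage.ThreeCongruenceHesseCertificatesBatch2
import Literature.NumberTheory.EllipticCurves.Fisher2012.HesseFamilyThreeReverseProofs
import Summits.BirchSwinnertonDyer.Rank1Residual.Additive.X4ThreeVisibleRowShape22752c1
import Summits.BirchSwinnertonDyer.Rank1Residual.Additive.X4ThreeVisibleRowShape26208h1
import Summits.BirchSwinnertonDyer.Rank1Residual.Additive.X4ThreeVisibleRowShape26262f1
import Summits.BirchSwinnertonDyer.Rank1Residual.Additive.X4ThreeVisibleRowShape27936q1
import Summits.BirchSwinnertonDyer.Rank1Residual.Additive.X4ThreeVisibleRowShape28224gl1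
import Summits.BirchSwinnertonDyer.Rank1Residual.Additive.X4ThreeVisibleRowShape28800be1
import Summits.BirchSwinnertonDyer.Rank1Residual.Additive.X4ThreeVisibleRowShape29241c1
import Summits.BirchSwinnertonDyer.BirchSwinnertonDyer.Theorems.Rank2ObservatoryKernelCerts557
import Summits.BirchSwinnertonDyer.BirchSwinnertonDyer.Theorems.Rank2ObservatoryKernelCertsF57
import Summits.BirchSwinnertonDyer.BirchSwinnertonDyer.Theorems.Rank2ObservatoryKernelCerts028
import Summits.BirchSwinnertonDyer.BirchSwinnertonDyer.Theorems.Rank2ObservatoryKernelCerts731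
import Summits.BirchSwinnertonDyer.BirchSwinnertonDyer.Theorems.Rank2ObservatoryKernelCertsT167
import Summits.BirchSwinnertonDyer.BirchSwinnertonDyer.Theorems.Rank2ObservatoryKernelCertsZ31
import Summits.BirchSwinnertonDyer.BirchSwinnertonDyer.Theorems.Rank2ObservatoryKernelCerts177
import HarnessLib

/-!
# The seven T-VIS3-REC BATCH-2 (PILOT) row shapes with the C-VIS `θ/hθ` column AND the rank column
# `hrank` DISCHARGED IN THE KERNEL — binders left = named facts + the analytic EVIDENCE columns
# (`r_an = 0`, `ord₃ #Ш_an ≤ 2`) (+ Manin datum on (G) rows) — the four DUAL rows A243-FREE via p02's `thm132rev_threeCongruent_dualHessePencil_holds`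
# (cell `b2b-bsdres`, team n1011, ROW T-VIS3-TH FILE 2b; seat p07 (gen 10); skeleton
# cells/n1011/skel/T-VIS3-TH.md; p18's batch-2 shapes consumed BY NAME, nothing of p18's edited)

HONEST FRAMING (cell `b2b-bsdres`, run/shared/lean/b2b/bsd-rank1-residual/, verbatim in every
file): the goal of the cell is to DELETE the COMBINATION-SHAPED residual classes of the
Birch–Swinnerton-Dyer formula for ALL analytic-rank `≤ 1` elliptic curves over `ℚ` — "full BSD
formula for every rank `≤ 1` curve in class `C`" assembled STRICTLY from published theorems — so
that the rank-`≤ 1` remainder becomes exactly the CONSTRUCTION-SHAPED classes, which are TYPED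
(missing-input `Prop`s), NOT attempted. This is not "finishing BSD". Team n1011 (N11 = X4 ∧ `p = 3`):
research route; RECORD theorems only — NO definition, NO new named fact, NO `sorry`; a record closes
NO class and moves no mark / label / count; nothing booked; census count unchanged.

## What

Same construction as ROW T-VIS3-TH FILE 2 (`Additive/X4ThreeVisibleRowShapesThetaFree.lean`) for the
batch-2 PILOT rows of n1011-p18's `Additive/X4ThreeVisibleRowShape<E>.lean` (E-side instances by
n1011-p14's `GaloisImage/VisThreeESideInstances1.lean`, lead R5-83 (i)): **`bsdp3_visHesse_v<E>`** =
`bsdp3_vis_v<E>` with `(W') (hW') [W'.IsElliptic] (θ) (hθ)` ↦ the literal partner + FILE 4's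
`VisCerts.torsionIso3_<E′>_<E>_of_integralModelInt` (three DIRECT pairs; the four DUAL pairs 22752c1, 26208h1, 28800be1, 29241c1 fed with
`Fisher2012.thm132rev_threeCongruent_dualHessePencil_holds` — n1011-p02 T-F132-3R p310178 — so NO `hF'` binder) and `(hrank)` ↦ the bsd-rank2-observatory
kernel certificates `KernelCerts557.C22752e1` / `KernelCertsF57.C26208k1` / `KernelCerts028.C2918b1` /
`KernelCerts731.C27936t1` / `KernelCertsT167.C28224gc1` / `KernelCertsZ31.C28800ba1` /
`KernelCerts177.C9747e1` `.two_le_rank`, by name. A243-free alternatives exist for three of the four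
dual rows with another symplectic partner (26208k2, 28800ba2, 29241j1 — n1011-p07 g10
`certs999/dual_to_direct_via_{isogeny,other_partner}.tsv`); they need their own row shapes first.

| row `E` | partner `E′` | `θ` | `rank E′ ≥ 2` | binders left besides the named facts |
|---|---|---|---|---|
| 22752c1 (M) | 22752e1 | kernel (dual, A243-free) | kernel (bsdr2) | `hr`, `hq/hv` |
| 26208h1 (M) | 26208k1 | kernel (dual, A243-free) | kernel (bsdr2) | `hr`, `hq/hv` |
| 26262f1 (G) | 2918b1 | kernel | kernel (bsdr2) | `hr`, `D/hc`, `hq/hv` |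
| 27936q1 (G) | 27936t1 | kernel | kernel (bsdr2) | `hr`, `D/hc`, `hq/hv` |
| 28224gl1 (M) | 28224gc1 | kernel | kernel (bsdr2) | `hr`, `hq/hv` |
| 28800be1 (G) | 28800ba1 | kernel (dual, A243-free) | kernel (bsdr2) | `hr`, `D/hc`, `hq/hv` |
| 29241c1 (G) | 9747e1 | kernel (dual, A243-free) | kernel (bsdr2) | `hr`, `D/hc`, `hq/hv` |

References: as FILE 2 [CremonaMazur2000] [Fisher2012Hessian] [CremonaAlgorithms1997] [SilvermanAEC2009];
cells/n1011/skel/T-VIS3-TH.md; skel/T-VIS3-REC-E.md (p14).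
-/

set_option autoImplicit false

noncomputable section

open scoped Classical NumberField
open IsDedekindDomain NumberField WeierstrassCurve Rat.HeightOneSpectrum
  Literature.NumberTheory.EllipticCurves Literature.NumberTheory.EllipticCurves.ModularForms
  Literature.NumberTheory.EllipticCurves.Rank1Residual
  Literature.NumberTheory.EllipticCurves.Rank1Residual.Typed
  Literature.NumberTheory.EllipticCurves.Fisher2012
  Literature.NumberTheory.GaloisRepresentations
  Summit.BirchSwinnertonDyer.BirchSwinnertonDyer.Rank1Residual.IntModel
  Summit.BirchSwinnertonDyer.BirchSwinnertonDyer.Rank1Residual.X11RankOne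
  Summit.BirchSwinnertonDyer.BirchSwinnertonDyer.Rank2Observatory.Tam
  Summit.BirchSwinnertonDyer.BirchSwinnertonDyer.Rank2Observatory
  Summit.BirchSwinnertonDyer.Rank1Residual.GaloisImage

namespace Summit.BirchSwinnertonDyer.Rank1Residual.Additive

/-! ### The seven batch-2 rows -/

/-- **T-VIS3 row `22752c1` with the C-VIS `θ/hθ` column AND the rank column `hrank` DISCHARGED IN THE
KERNEL** — p18's row shape `bsdp3_vis_v22752c1` (`BSD(E,3)` for `E = 22752c1 = [0, 0, 0, -19209,
-1022560]` from its `3`-congruent rank-2 partner `E′ = 22752e1 = [0, 0, 0, -12, 1280]`, every local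
binder in the kernel) fed with `VisCerts.torsionIso3_22752e1_22752c1_of_integralModelInt` (ROW
T-VIS3-TH FILE 1: DUAL certificate (1920 : 1), u = 1/24 — anti-symplectic, A243 discharged by
`thm132rev_threeCongruent_dualHessePencil_holds`) and with `2 ≤ rank E′(ℚ)` from
bsd-rank2-observatory KERNEL certificate `Rank2Observatory.KernelCerts557.C22752e1.two_le_rank`.
BINDERS LEFT = {named facts, hr (r_an = 0), hq/hv (ord₃ #Ш_an ≤ 2)} — the analytic EVIDENCE columns
only (lead R5-82 (d)); the partner `E′` no longer appears in the statement (its ellipticity, the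
congruence and its rank are kernel facts); closes nothing beyond the displayed binders; nothing
booked; census count unchanged.
[cite: CremonaMazur2000, §3 and Table 1] [cite: Fisher2012Hessian, §13 (analogue of Thm. 13.2 for X_E^-(3))] -/
theorem bsdp3_visHesse_v22752c1
    (hKatoS : Kato2004.rankZero_padicValNat_sha_le_sub_localTamagawa_of_additive_potGood_of_imageContainsSL2)
    (hDel : Delbourgo1998.prop4_rankZero_pow_dvd_constantCoeff)
    (hGZK : rank_eq_analyticRank_of_analyticRank_le_one) (hmod : hasEntireLFunction_rat)
    (hmodD : nonempty_modularParametrizationData)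
    (hKatoχ : Wuthrich2014.kato_halfEigenCharIdeal_dvd_cyclotomicPrime_of_surjective)
    (hCT : exists_casselsTate_pairing (K := ℚ))
    (W : WeierstrassCurve ℚ) [W.IsElliptic] [W.IsGloballyMinimal]
    (hI : integralModelInt W = ⟨0, 0, 0, -19209, -1022560⟩)
    (hr : W.analyticRank = 0)
    {q : ℚ} (hq : shaAn W = (q : ℂ)) (hv : padicValRat 3 q ≤ 2) :
    haveI : Fact (Nat.Prime 3) := ⟨Nat.prime_three⟩
    BSDp W 3 := by
  haveI : (⟨0, 0, 0, -12, 1280⟩ : WeierstrassCurve ℚ).IsElliptic :=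
    ⟨by rw [isUnit_iff_ne_zero]
        norm_num [WeierstrassCurve.Δ, WeierstrassCurve.b₂, WeierstrassCurve.b₄, WeierstrassCurve.b₆,
          WeierstrassCurve.b₈]⟩
  obtain ⟨θ, hθ⟩ := VisCerts.torsionIso3_22752e1_22752c1_of_integralModelInt thm132rev_threeCongruent_dualHessePencil_holds W hI ⟨0, 0, 0, -12, 1280⟩ rfl
  have hE' : (⟨0, 0, 0, -12, 1280⟩ : WeierstrassCurve ℤ).map (Int.castRingHom ℚ) =
      (⟨0, 0, 0, -12, 1280⟩ : WeierstrassCurve ℚ) := by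
    ext <;> simp [WeierstrassCurve.map]
  have hrank : 2 ≤ (⟨0, 0, 0, -12, 1280⟩ : WeierstrassCurve ℚ).mordellWeilRank := by
    rw [← hE']; exact KernelCerts557.C22752e1.two_le_rank
  exact bsdp3_vis_v22752c1 hKatoS hDel hGZK hmod hmodD hKatoχ hCT W hI hr hq hv _ rfl θ hθ hrank

/-- **T-VIS3 row `26208h1` with the C-VIS `θ/hθ` column AND the rank column `hrank` DISCHARGED IN THE
KERNEL** — p18's row shape `bsdp3_vis_v26208h1` (`BSD(E,3)` for `E = 26208h1 = [0, 0, 0, -114267,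
-17675278]` from its `3`-congruent rank-2 partner `E′ = 26208k1 = [0, 0, 0, -381, 380]`, every local
binder in the kernel) fed with `VisCerts.torsionIso3_26208k1_26208h1_of_integralModelInt` (ROW
T-VIS3-TH FILE 1: DUAL certificate (−148164 : 37), u = 1/12 — anti-symplectic, A243 discharged by
`thm132rev_threeCongruent_dualHessePencil_holds`) and with `2 ≤ rank E′(ℚ)` from
bsd-rank2-observatory KERNEL certificate `Rank2Observatory.KernelCertsF57.C26208k1.two_le_rank`.
BINDERS LEFT = {named facts, hr (r_an = 0), hq/hv (ord₃ #Ш_an ≤ 2)} — the analytic EVIDENCE columns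
only (lead R5-82 (d)); the partner `E′` no longer appears in the statement (its ellipticity, the
congruence and its rank are kernel facts); closes nothing beyond the displayed binders; nothing
booked; census count unchanged.
[cite: CremonaMazur2000, §3 and Table 1] [cite: Fisher2012Hessian, §13 (analogue of Thm. 13.2 for X_E^-(3))] -/
theorem bsdp3_visHesse_v26208h1
    (hKatoS : Kato2004.rankZero_padicValNat_sha_le_sub_localTamagawa_of_additive_potGood_of_imageContainsSL2)
    (hDel : Delbourgo1998.prop4_rankZero_pow_dvd_constantCoeff)
    (hGZK : rank_eq_analyticRank_of_analyticRank_le_one) (hmod : hasEntireLFunction_rat)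
    (hmodD : nonempty_modularParametrizationData)
    (hKatoχ : Wuthrich2014.kato_halfEigenCharIdeal_dvd_cyclotomicPrime_of_surjective)
    (hCT : exists_casselsTate_pairing (K := ℚ))
    (W : WeierstrassCurve ℚ) [W.IsElliptic] [W.IsGloballyMinimal]
    (hI : integralModelInt W = ⟨0, 0, 0, -114267, -17675278⟩)
    (hr : W.analyticRank = 0)
    {q : ℚ} (hq : shaAn W = (q : ℂ)) (hv : padicValRat 3 q ≤ 2) :
    haveI : Fact (Nat.Prime 3) := ⟨Nat.prime_three⟩
    BSDp W 3 := by
  haveI : (⟨0, 0, 0, -381, 380⟩ : WeierstrassCurve ℚ).IsElliptic :=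
    ⟨by rw [isUnit_iff_ne_zero]
        norm_num [WeierstrassCurve.Δ, WeierstrassCurve.b₂, WeierstrassCurve.b₄, WeierstrassCurve.b₆,
          WeierstrassCurve.b₈]⟩
  obtain ⟨θ, hθ⟩ := VisCerts.torsionIso3_26208k1_26208h1_of_integralModelInt thm132rev_threeCongruent_dualHessePencil_holds W hI ⟨0, 0, 0, -381, 380⟩ rfl
  have hE' : (⟨0, 0, 0, -381, 380⟩ : WeierstrassCurve ℤ).map (Int.castRingHom ℚ) =
      (⟨0, 0, 0, -381, 380⟩ : WeierstrassCurve ℚ) := by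
    ext <;> simp [WeierstrassCurve.map]
  have hrank : 2 ≤ (⟨0, 0, 0, -381, 380⟩ : WeierstrassCurve ℚ).mordellWeilRank := by
    rw [← hE']; exact KernelCertsF57.C26208k1.two_le_rank
  exact bsdp3_vis_v26208h1 hKatoS hDel hGZK hmod hmodD hKatoχ hCT W hI hr hq hv _ rfl θ hθ hrank

/-- **T-VIS3 row `26262f1` with the C-VIS `θ/hθ` column AND the rank column `hrank` DISCHARGED IN THE
KERNEL** — p18's row shape `bsdp3_vis_v26262f1` (`BSD(E,3)` for `E = 26262f1 = [1, -1, 1, -839,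
-9125]` from its `3`-congruent rank-2 partner `E′ = 2918b1 = [1, 0, 0, -80, 256]`, every local
binder in the kernel) fed with `VisCerts.torsionIso3_2918b1_26262f1_of_integralModelInt` (ROW
T-VIS3-TH FILE 1: DIRECT certificate (−243 : 1), u = 108) and with `2 ≤ rank E′(ℚ)` from
bsd-rank2-observatory KERNEL certificate `Rank2Observatory.KernelCerts028.C2918b1.two_le_rank`.
BINDERS LEFT = {named facts, hr (r_an = 0), hq/hv (ord₃ #Ш_an ≤ 2), D/hc (Manin datum)} — the
analytic EVIDENCE columns only (lead R5-82 (d)); the partner `E′` no longer appears in the statement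
(its ellipticity, the congruence and its rank are kernel facts); closes nothing beyond the displayed
binders; nothing booked; census count unchanged.
[cite: CremonaMazur2000, §3 and Table 1] [cite: Fisher2012Hessian, Thm. 13.2 (n = 3)] -/
theorem bsdp3_visHesse_v26262f1
    (hKato : Kato2004.rankZero_padicValNat_sha_le_of_additive_potGood_of_imageContainsSL2)
    (hCT : exists_casselsTate_pairing (K := ℚ))
    (hGZK : rank_eq_analyticRank_of_analyticRank_le_one) (hmod : hasEntireLFunction_rat)
    (W : WeierstrassCurve ℚ) [W.IsElliptic] [W.IsGloballyMinimal]
    (hI : integralModelInt W = ⟨1, -1, 1, -839, -9125⟩)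
    (hr : W.analyticRank = 0)
    {N : ℕ} [NeZero N] (D : ModularParametrizationData W N) (hc : ¬ ((3 : ℕ) : ℤ) ∣ D.maninConstant)
    {q : ℚ} (hq : shaAn W = (q : ℂ)) (hv : padicValRat 3 q ≤ 2) :
    haveI : Fact (Nat.Prime 3) := ⟨Nat.prime_three⟩
    BSDp W 3 := by
  haveI : (⟨1, 0, 0, -80, 256⟩ : WeierstrassCurve ℚ).IsElliptic :=
    ⟨by rw [isUnit_iff_ne_zero]
        norm_num [WeierstrassCurve.Δ, WeierstrassCurve.b₂, WeierstrassCurve.b₄, WeierstrassCurve.b₆,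
          WeierstrassCurve.b₈]⟩
  obtain ⟨θ, hθ⟩ := VisCerts.torsionIso3_2918b1_26262f1_of_integralModelInt W hI ⟨1, 0, 0, -80, 256⟩ rfl
  have hE' : (⟨1, 0, 0, -80, 256⟩ : WeierstrassCurve ℤ).map (Int.castRingHom ℚ) =
      (⟨1, 0, 0, -80, 256⟩ : WeierstrassCurve ℚ) := by
    ext <;> simp [WeierstrassCurve.map]
  have hrank : 2 ≤ (⟨1, 0, 0, -80, 256⟩ : WeierstrassCurve ℚ).mordellWeilRank := by
    rw [← hE']; exact KernelCerts028.C2918b1.two_le_rank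
  exact bsdp3_vis_v26262f1 hKato hCT hGZK hmod W hI hr D hc hq hv _ rfl θ hθ hrank

/-- **T-VIS3 row `27936q1` with the C-VIS `θ/hθ` column AND the rank column `hrank` DISCHARGED IN THE
KERNEL** — p18's row shape `bsdp3_vis_v27936q1` (`BSD(E,3)` for `E = 27936q1 = [0, 0, 0, -84645,
-9492336]` from its `3`-congruent rank-2 partner `E′ = 27936t1 = [0, 0, 0, -1944, 33264]`, every
local binder in the kernel) fed with `VisCerts.torsionIso3_27936t1_27936q1_of_integralModelInt` (ROW
T-VIS3-TH FILE 1: DIRECT certificate (−1788 : 1), u = 1164) and with `2 ≤ rank E′(ℚ)` from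
bsd-rank2-observatory KERNEL certificate `Rank2Observatory.KernelCerts731.C27936t1.two_le_rank`.
BINDERS LEFT = {named facts, hr (r_an = 0), hq/hv (ord₃ #Ш_an ≤ 2), D/hc (Manin datum)} — the
analytic EVIDENCE columns only (lead R5-82 (d)); the partner `E′` no longer appears in the statement
(its ellipticity, the congruence and its rank are kernel facts); closes nothing beyond the displayed
binders; nothing booked; census count unchanged.
[cite: CremonaMazur2000, §3 and Table 1] [cite: Fisher2012Hessian, Thm. 13.2 (n = 3)] -/
theorem bsdp3_visHesse_v27936q1
    (hKato : Kato2004.rankZero_padicValNat_sha_le_of_additive_potGood_of_imageContainsSL2)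
    (hCT : exists_casselsTate_pairing (K := ℚ))
    (hGZK : rank_eq_analyticRank_of_analyticRank_le_one) (hmod : hasEntireLFunction_rat)
    (W : WeierstrassCurve ℚ) [W.IsElliptic] [W.IsGloballyMinimal]
    (hI : integralModelInt W = ⟨0, 0, 0, -84645, -9492336⟩)
    (hr : W.analyticRank = 0)
    {N : ℕ} [NeZero N] (D : ModularParametrizationData W N) (hc : ¬ ((3 : ℕ) : ℤ) ∣ D.maninConstant)
    {q : ℚ} (hq : shaAn W = (q : ℂ)) (hv : padicValRat 3 q ≤ 2) :
    haveI : Fact (Nat.Prime 3) := ⟨Nat.prime_three⟩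
    BSDp W 3 := by
  haveI : (⟨0, 0, 0, -1944, 33264⟩ : WeierstrassCurve ℚ).IsElliptic :=
    ⟨by rw [isUnit_iff_ne_zero]
        norm_num [WeierstrassCurve.Δ, WeierstrassCurve.b₂, WeierstrassCurve.b₄, WeierstrassCurve.b₆,
          WeierstrassCurve.b₈]⟩
  obtain ⟨θ, hθ⟩ := VisCerts.torsionIso3_27936t1_27936q1_of_integralModelInt W hI ⟨0, 0, 0, -1944, 33264⟩ rfl
  have hE' : (⟨0, 0, 0, -1944, 33264⟩ : WeierstrassCurve ℤ).map (Int.castRingHom ℚ) =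
      (⟨0, 0, 0, -1944, 33264⟩ : WeierstrassCurve ℚ) := by
    ext <;> simp [WeierstrassCurve.map]
  have hrank : 2 ≤ (⟨0, 0, 0, -1944, 33264⟩ : WeierstrassCurve ℚ).mordellWeilRank := by
    rw [← hE']; exact KernelCerts731.C27936t1.two_le_rank
  exact bsdp3_vis_v27936q1 hKato hCT hGZK hmod W hI hr D hc hq hv _ rfl θ hθ hrank

/-- **T-VIS3 row `28224gl1` with the C-VIS `θ/hθ` column AND the rank column `hrank` DISCHARGED IN THE
KERNEL** — p18's row shape `bsdp3_vis_v28224gl1` (`BSD(E,3)` for `E = 28224gl1 = [0, 0, 0, 69972,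
-151935280]` from its `3`-congruent rank-2 partner `E′ = 28224gc1 = [0, 0, 0, -336, -1960]`, every
local binder in the kernel) fed with `VisCerts.torsionIso3_28224gc1_28224gl1_of_integralModelInt`
(ROW T-VIS3-TH FILE 1: DIRECT certificate (5880 : 1), u = 56448) and with `2 ≤ rank E′(ℚ)` from
bsd-rank2-observatory KERNEL certificate `Rank2Observatory.KernelCertsT167.C28224gc1.two_le_rank`.
BINDERS LEFT = {named facts, hr (r_an = 0), hq/hv (ord₃ #Ш_an ≤ 2)} — the analytic EVIDENCE columns
only (lead R5-82 (d)); the partner `E′` no longer appears in the statement (its ellipticity, the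
congruence and its rank are kernel facts); closes nothing beyond the displayed binders; nothing
booked; census count unchanged.
[cite: CremonaMazur2000, §3 and Table 1] [cite: Fisher2012Hessian, Thm. 13.2 (n = 3)] -/
theorem bsdp3_visHesse_v28224gl1
    (hKatoS : Kato2004.rankZero_padicValNat_sha_le_sub_localTamagawa_of_additive_potGood_of_imageContainsSL2)
    (hDel : Delbourgo1998.prop4_rankZero_pow_dvd_constantCoeff)
    (hGZK : rank_eq_analyticRank_of_analyticRank_le_one) (hmod : hasEntireLFunction_rat)
    (hmodD : nonempty_modularParametrizationData)
    (hKatoχ : Wuthrich2014.kato_halfEigenCharIdeal_dvd_cyclotomicPrime_of_surjective)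
    (hCT : exists_casselsTate_pairing (K := ℚ))
    (W : WeierstrassCurve ℚ) [W.IsElliptic] [W.IsGloballyMinimal]
    (hI : integralModelInt W = ⟨0, 0, 0, 69972, -151935280⟩)
    (hr : W.analyticRank = 0)
    {q : ℚ} (hq : shaAn W = (q : ℂ)) (hv : padicValRat 3 q ≤ 2) :
    haveI : Fact (Nat.Prime 3) := ⟨Nat.prime_three⟩
    BSDp W 3 := by
  haveI : (⟨0, 0, 0, -336, -1960⟩ : WeierstrassCurve ℚ).IsElliptic :=
    ⟨by rw [isUnit_iff_ne_zero]
        norm_num [WeierstrassCurve.Δ, WeierstrassCurve.b₂, WeierstrassCurve.b₄, WeierstrassCurve.b₆,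
          WeierstrassCurve.b₈]⟩
  obtain ⟨θ, hθ⟩ := VisCerts.torsionIso3_28224gc1_28224gl1_of_integralModelInt W hI ⟨0, 0, 0, -336, -1960⟩ rfl
  have hE' : (⟨0, 0, 0, -336, -1960⟩ : WeierstrassCurve ℤ).map (Int.castRingHom ℚ) =
      (⟨0, 0, 0, -336, -1960⟩ : WeierstrassCurve ℚ) := by
    ext <;> simp [WeierstrassCurve.map]
  have hrank : 2 ≤ (⟨0, 0, 0, -336, -1960⟩ : WeierstrassCurve ℚ).mordellWeilRank := by
    rw [← hE']; exact KernelCertsT167.C28224gc1.two_le_rank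
  exact bsdp3_vis_v28224gl1 hKatoS hDel hGZK hmod hmodD hKatoχ hCT W hI hr hq hv _ rfl θ hθ hrank

/-- **T-VIS3 row `28800be1` with the C-VIS `θ/hθ` column AND the rank column `hrank` DISCHARGED IN THE
KERNEL** — p18's row shape `bsdp3_vis_v28800be1` (`BSD(E,3)` for `E = 28800be1 = [0, 0, 0, -5625,
-168750]` from its `3`-congruent rank-2 partner `E′ = 28800ba1 = [0, 0, 0, -450, 13500]`, every
local binder in the kernel) fed with `VisCerts.torsionIso3_28800ba1_28800be1_of_integralModelInt`
(ROW T-VIS3-TH FILE 1: DUAL certificate (1 : 0), u = 1/108000 — anti-symplectic, A243 discharged by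
`thm132rev_threeCongruent_dualHessePencil_holds`) and with `2 ≤ rank E′(ℚ)` from
bsd-rank2-observatory KERNEL certificate `Rank2Observatory.KernelCertsZ31.C28800ba1.two_le_rank`.
BINDERS LEFT = {named facts, hr (r_an = 0), hq/hv (ord₃ #Ш_an ≤ 2), D/hc (Manin datum)} — the
analytic EVIDENCE columns only (lead R5-82 (d)); the partner `E′` no longer appears in the statement
(its ellipticity, the congruence and its rank are kernel facts); closes nothing beyond the displayed
binders; nothing booked; census count unchanged.
[cite: CremonaMazur2000, §3 and Table 1] [cite: Fisher2012Hessian, §13 (analogue of Thm. 13.2 for X_E^-(3))] -/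
theorem bsdp3_visHesse_v28800be1
    (hKato : Kato2004.rankZero_padicValNat_sha_le_of_additive_potGood_of_imageContainsSL2)
    (hCT : exists_casselsTate_pairing (K := ℚ))
    (hGZK : rank_eq_analyticRank_of_analyticRank_le_one) (hmod : hasEntireLFunction_rat)
    (W : WeierstrassCurve ℚ) [W.IsElliptic] [W.IsGloballyMinimal]
    (hI : integralModelInt W = ⟨0, 0, 0, -5625, -168750⟩)
    (hr : W.analyticRank = 0)
    {N : ℕ} [NeZero N] (D : ModularParametrizationData W N) (hc : ¬ ((3 : ℕ) : ℤ) ∣ D.maninConstant)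
    {q : ℚ} (hq : shaAn W = (q : ℂ)) (hv : padicValRat 3 q ≤ 2) :
    haveI : Fact (Nat.Prime 3) := ⟨Nat.prime_three⟩
    BSDp W 3 := by
  haveI : (⟨0, 0, 0, -450, 13500⟩ : WeierstrassCurve ℚ).IsElliptic :=
    ⟨by rw [isUnit_iff_ne_zero]
        norm_num [WeierstrassCurve.Δ, WeierstrassCurve.b₂, WeierstrassCurve.b₄, WeierstrassCurve.b₆,
          WeierstrassCurve.b₈]⟩
  obtain ⟨θ, hθ⟩ := VisCerts.torsionIso3_28800ba1_28800be1_of_integralModelInt thm132rev_threeCongruent_dualHessePencil_holds W hI ⟨0, 0, 0, -450, 13500⟩ rfl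
  have hE' : (⟨0, 0, 0, -450, 13500⟩ : WeierstrassCurve ℤ).map (Int.castRingHom ℚ) =
      (⟨0, 0, 0, -450, 13500⟩ : WeierstrassCurve ℚ) := by
    ext <;> simp [WeierstrassCurve.map]
  have hrank : 2 ≤ (⟨0, 0, 0, -450, 13500⟩ : WeierstrassCurve ℚ).mordellWeilRank := by
    rw [← hE']; exact KernelCertsZ31.C28800ba1.two_le_rank
  exact bsdp3_vis_v28800be1 hKato hCT hGZK hmod W hI hr D hc hq hv _ rfl θ hθ hrank

/-- **T-VIS3 row `29241c1` with the C-VIS `θ/hθ` column AND the rank column `hrank` DISCHARGED IN THE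
KERNEL** — p18's row shape `bsdp3_vis_v29241c1` (`BSD(E,3)` for `E = 29241c1 = [1, -1, 0, -24435,
1012024]` from its `3`-congruent rank-2 partner `E′ = 9747e1 = [0, 0, 1, -57, 166]`, every local
binder in the kernel) fed with `VisCerts.torsionIso3_9747e1_29241c1_of_integralModelInt` (ROW
T-VIS3-TH FILE 1: DUAL certificate (1083 : 1), u = 1/228 — anti-symplectic, A243 discharged by
`thm132rev_threeCongruent_dualHessePencil_holds`) and with `2 ≤ rank E′(ℚ)` from
bsd-rank2-observatory KERNEL certificate `Rank2Observatory.KernelCerts177.C9747e1.two_le_rank`.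
BINDERS LEFT = {named facts, hr (r_an = 0), hq/hv (ord₃ #Ш_an ≤ 2), D/hc (Manin datum)} — the
analytic EVIDENCE columns only (lead R5-82 (d)); the partner `E′` no longer appears in the statement
(its ellipticity, the congruence and its rank are kernel facts); closes nothing beyond the displayed
binders; nothing booked; census count unchanged.
[cite: CremonaMazur2000, §3 and Table 1] [cite: Fisher2012Hessian, §13 (analogue of Thm. 13.2 for X_E^-(3))] -/
theorem bsdp3_visHesse_v29241c1
    (hKato : Kato2004.rankZero_padicValNat_sha_le_of_additive_potGood_of_imageContainsSL2)
    (hCT : exists_casselsTate_pairing (K := ℚ))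
    (hGZK : rank_eq_analyticRank_of_analyticRank_le_one) (hmod : hasEntireLFunction_rat)
    (W : WeierstrassCurve ℚ) [W.IsElliptic] [W.IsGloballyMinimal]
    (hI : integralModelInt W = ⟨1, -1, 0, -24435, 1012024⟩)
    (hr : W.analyticRank = 0)
    {N : ℕ} [NeZero N] (D : ModularParametrizationData W N) (hc : ¬ ((3 : ℕ) : ℤ) ∣ D.maninConstant)
    {q : ℚ} (hq : shaAn W = (q : ℂ)) (hv : padicValRat 3 q ≤ 2) :
    haveI : Fact (Nat.Prime 3) := ⟨Nat.prime_three⟩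
    BSDp W 3 := by
  haveI : (⟨0, 0, 1, -57, 166⟩ : WeierstrassCurve ℚ).IsElliptic :=
    ⟨by rw [isUnit_iff_ne_zero]
        norm_num [WeierstrassCurve.Δ, WeierstrassCurve.b₂, WeierstrassCurve.b₄, WeierstrassCurve.b₆,
          WeierstrassCurve.b₈]⟩
  obtain ⟨θ, hθ⟩ := VisCerts.torsionIso3_9747e1_29241c1_of_integralModelInt thm132rev_threeCongruent_dualHessePencil_holds W hI ⟨0, 0, 1, -57, 166⟩ rfl
  have hE' : (⟨0, 0, 1, -57, 166⟩ : WeierstrassCurve ℤ).map (Int.castRingHom ℚ) =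
      (⟨0, 0, 1, -57, 166⟩ : WeierstrassCurve ℚ) := by
    ext <;> simp [WeierstrassCurve.map]
  have hrank : 2 ≤ (⟨0, 0, 1, -57, 166⟩ : WeierstrassCurve ℚ).mordellWeilRank := by
    rw [← hE']; exact KernelCerts177.C9747e1.two_le_rank
  exact bsdp3_vis_v29241c1 hKato hCT hGZK hmod W hI hr D hc hq hv _ rfl θ hθ hrank

end Summit.BirchSwinnertonDyer.Rank1Residual.Additive

end
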